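import Mathlib
import Summits.ValiantsHypothesis.ValiantsHypothesis.Theses.FeketeSOS
import Summits.ValiantsHypothesis.ValiantsHypothesis.Theorems.FeketeSOSSublinearShadowTrivialShadow
import Summits.ValiantsHypothesis.ValiantsHypothesis.Theorems.FeketeSOSSublinearShadowThreeSquares
import Summits.ValiantsHypothesis.ValiantsHypothesis.Theorems.FeketeSOSSublinearShadowTwoDeepShadow

/-!
# `FeketeSOS.SublinearShadow` (stmt-ValiantsHypothesis-14990), line `Sketch`, reshape 4 — THE EVERYWHERE-DEEP CORE

`sublinearShadow_iff_coreFewDeep`: the crux `SublinearShadow` is EQUIVALENT to its restriction to complex representations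
`Σ_{i<s} c_i g_i² = F_p` (`deg g_i ≤ p²`, support-sum `S`, `S⁴ ≤ p³`) with `3 ≤ s` squares, FEW squares
(`(s+1)^A · S < 2p`), PARETO-MINIMAL support-sum among representations with `≤ s` squares, AND AT LEAST THREE
non-`O`-integral terms `c_i g_i²` at EVERY valuation subring `O ⊂ ℂ` with `p ∈ 𝔪_O` — with the crux's own conclusion
block.  Compared with `sublinearShadow_iff_coreFew` (reshape 3, p106582) the new normalising hypothesis is the
everywhere-deep condition; it is bought by the TWO-DEEP TRANSFER `stub_twoDeepShadow`
(`Theorems/FeketeSOSSublinearShadowTwoDeepShadow.lean`): a place over `p` at which at most two terms fail to be integral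
yields a cyclic characteristic-`p` shadow with `s` squares and support `≤ 2S` (the two terms merge into a product, Gauss's
lemma makes both factors integral, `A'B' = ¼(A'+B')² − ¼(A'−B')²`, then `depthZeroShadow_proof`).

`→` is restriction.  `←` (constants `A ↦ A + 1`, `p₁ ↦ max p₁ 257`): Pareto-minimal representative by `Nat.find`,
`≥ 3` squares (`stub_threeSquares`), the universal two-square shadow over `ZMod p` (`stub_trivialShadow`) when
`2p ≤ (s₀+1)^A · S₀`; otherwise either some place has `≤ 2` non-integral terms (`stub_twoDeepShadow`, `d = s₀ ≤ s+1`,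
support `≤ 2S₀`) or the core applies to the minimal representation; monotonicity of both budgets.

For `s = 3` the residual class is: all three terms deep at every place over `p` (lead c2's prose residual, now formal).
-/

namespace Summit.ValiantsHypothesis.ValiantsHypothesis.Theorems.SublinearShadowSketch

open Polynomial Finset IsLocalRing
open scoped BigOperators

-- `Summit.ValiantsHypothesis.ValiantsHypothesis.…` is the tree's mandated single-conjunct layout (Sub = Summit).
set_option linter.dupNamespace false

/-- **The crux ⟺ its everywhere-deep few-squares Pareto-minimal core.**  `FeketeSOS.SublinearShadow` holds iff, for
some `A, p₁` and all primes `p ≥ p₁`, every complex representation `Σ_{i<s} c_i g_i² = F_p` with `deg g_i ≤ p²`,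
`S⁴ ≤ p³` (`S = Σ|supp g_i|`), `3 ≤ s`, `(s+1)^A · S < 2p`, Pareto-minimal support-sum among representations with `≤ s`
squares, and at least three non-`O`-integral terms at every valuation subring `O ⊂ ℂ` with `p ∈ 𝔪_O`, has a cyclic
characteristic-`p` shadow with `≤ (s+1)^A` squares of degree `< p` and support `≤ (s+1)^A · S`. -/
theorem sublinearShadow_iff_coreFewDeep :
    Summit.ValiantsHypothesis.ValiantsHypothesis.Theses.FeketeSOS.SublinearShadow ↔
    ∃ A p₁ : ℕ, ∀ (p : ℕ) [Fact p.Prime], p₁ ≤ p → ∀ (s : ℕ) (c : Fin s → ℂ) (g : Fin s → Polynomial ℂ),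
      (∀ i, (g i).natDegree ≤ p ^ 2) → (∑ i, (g i).support.card) ^ 4 ≤ p ^ 3 →
      (∑ i, Polynomial.C (c i) * g i ^ 2)
        = ∑ m ∈ Finset.range p, Polynomial.C ((legendreSym p m : ℤ) : ℂ) * Polynomial.X ^ m →
      3 ≤ s → (s + 1) ^ A * (∑ i, (g i).support.card) < 2 * p →
      (∀ (s' : ℕ) (c' : Fin s' → ℂ) (g' : Fin s' → Polynomial ℂ), s' ≤ s →
        (∀ i, (g' i).natDegree ≤ p ^ 2) →
        (∑ i, Polynomial.C (c' i) * g' i ^ 2)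
          = ∑ m ∈ Finset.range p, Polynomial.C ((legendreSym p m : ℤ) : ℂ) * Polynomial.X ^ m →
        (∑ i, (g i).support.card) ≤ ∑ i, (g' i).support.card) →
      (∀ O : ValuationSubring ℂ, ((p : ℕ) : O) ∈ maximalIdeal O → ∀ i j : Fin s,
        ∃ k, k ≠ i ∧ k ≠ j ∧ ∃ n, (Polynomial.C (c k) * g k ^ 2).coeff n ∉ O) →
      ∃ (K : Type) (_ : Field K) (_ : CharP K p) (d : ℕ) (c' : Fin d → K) (g' : Fin d → Polynomial K),
        d ≤ (s + 1) ^ A ∧ (∀ j, (g' j).natDegree < p) ∧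
        (∑ j, (g' j).support.card) ≤ (s + 1) ^ A * ∑ i, (g i).support.card ∧
        ((Polynomial.X : Polynomial K) ^ p - 1 ∣ (∑ j, Polynomial.C (c' j) * g' j ^ 2)
          - ∑ m ∈ Finset.range p, Polynomial.C ((legendreSym p m : ℤ) : K) * Polynomial.X ^ m) := by
  constructor
  · -- restriction: drop the four normalising hypotheses
    rintro ⟨A, p₁, H⟩
    exact ⟨A, p₁, fun p _ hp s c g hdeg hS hrep _ _ _ _ => H p hp s c g hdeg hS hrep⟩
  · rintro ⟨A, p₁, H⟩
    unfold Summit.ValiantsHypothesis.ValiantsHypothesis.Theses.FeketeSOS.SublinearShadow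
    refine ⟨A + 1, max p₁ 257, ?_⟩
    intro p _ hp s c g hdeg hS hrep
    classical
    have hprime : p.Prime := Fact.out
    have hp₁ : p₁ ≤ p := le_trans (le_max_left _ _) hp
    have hp257 : 257 ≤ p := le_trans (le_max_right _ _) hp
    have hp2 : p ≠ 2 := by omega
    -- Step 0: a Pareto-minimal representation below `(s, c, g)`
    set Srep : ℕ := ∑ i, (g i).support.card with hSrep
    have hex : ∃ n, ∃ (s' : ℕ) (c' : Fin s' → ℂ) (g' : Fin s' → Polynomial ℂ), s' ≤ s ∧
        (∀ i, (g' i).natDegree ≤ p ^ 2) ∧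
        (∑ i, Polynomial.C (c' i) * g' i ^ 2)
          = ∑ m ∈ Finset.range p, Polynomial.C ((legendreSym p m : ℤ) : ℂ) * Polynomial.X ^ m ∧
        (∑ i, (g' i).support.card) = n := ⟨Srep, s, c, g, le_rfl, hdeg, hrep, rfl⟩
    obtain ⟨s₀, c₀, g₀, hs₀, hdeg₀, hrep₀, hS₀⟩ := Nat.find_spec hex
    have hmin₀ : ∀ (s' : ℕ) (c' : Fin s' → ℂ) (g' : Fin s' → Polynomial ℂ), s' ≤ s →
        (∀ i, (g' i).natDegree ≤ p ^ 2) →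
        (∑ i, Polynomial.C (c' i) * g' i ^ 2)
          = ∑ m ∈ Finset.range p, Polynomial.C ((legendreSym p m : ℤ) : ℂ) * Polynomial.X ^ m →
        Nat.find hex ≤ ∑ i, (g' i).support.card :=
      fun s' c' g' hs' hdeg' hrep' => Nat.find_min' hex ⟨s', c', g', hs', hdeg', hrep', rfl⟩
    set S₀ : ℕ := ∑ i, (g₀ i).support.card with hS₀def
    have hS₀le : S₀ ≤ Srep := by rw [hS₀]; exact hmin₀ s c g le_rfl hdeg hrep
    have hS₀4 : S₀ ^ 4 ≤ p ^ 3 := le_trans (Nat.pow_le_pow_left hS₀le 4) hS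
    have hmin : ∀ (s' : ℕ) (c' : Fin s' → ℂ) (g' : Fin s' → Polynomial ℂ), s' ≤ s₀ →
        (∀ i, (g' i).natDegree ≤ p ^ 2) →
        (∑ i, Polynomial.C (c' i) * g' i ^ 2)
          = ∑ m ∈ Finset.range p, Polynomial.C ((legendreSym p m : ℤ) : ℂ) * Polynomial.X ^ m →
        S₀ ≤ ∑ i, (g' i).support.card := fun s' c' g' hs' hdeg' hrep' => by
      rw [hS₀]; exact hmin₀ s' c' g' (hs'.trans hs₀) hdeg' hrep'
    -- Step 1: at least three squares
    have h3 : 3 ≤ s₀ := stub_threeSquares p hp257 s₀ c₀ g₀ hS₀4 hrep₀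
    have hs1 : (s₀ + 1) ^ A ≤ (s + 1) ^ A := Nat.pow_le_pow_left (Nat.succ_le_succ hs₀) A
    have hsA : (s + 1) ^ A ≤ (s + 1) ^ (A + 1) := Nat.pow_le_pow_right (Nat.succ_pos s) (Nat.le_succ A)
    have hsucc : s + 1 ≤ (s + 1) ^ (A + 1) := Nat.le_self_pow (Nat.succ_ne_zero A) _
    by_cases hmany : 2 * p ≤ (s₀ + 1) ^ A * S₀
    · -- Step 2a: many squares — the trivial two-square shadow over `ZMod p`
      obtain ⟨c', g', hdeg', hcard', hrep'⟩ := stub_trivialShadow p hp2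
      refine ⟨ZMod p, inferInstance, inferInstance, 2, c', g', ?_, hdeg', ?_, ?_⟩
      · calc 2 ≤ s₀ + 1 := by omega
          _ ≤ (s₀ + 1) ^ (A + 1) := Nat.le_self_pow (Nat.succ_ne_zero A) _
          _ ≤ (s + 1) ^ (A + 1) := Nat.pow_le_pow_left (Nat.succ_le_succ hs₀) (A + 1)
      · calc ∑ j, (g' j).support.card ≤ 2 * p := hcard'
          _ ≤ (s₀ + 1) ^ A * S₀ := hmany
          _ ≤ (s + 1) ^ (A + 1) * Srep := Nat.mul_le_mul (hs1.trans hsA) hS₀le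
      · rw [hrep', sub_self]; exact dvd_zero _
    · push Not at hmany
      by_cases hdeep : ∀ O : ValuationSubring ℂ, ((p : ℕ) : O) ∈ maximalIdeal O → ∀ i j : Fin s₀,
          ∃ k, k ≠ i ∧ k ≠ j ∧ ∃ n, (Polynomial.C (c₀ k) * g₀ k ^ 2).coeff n ∉ O
      · -- Step 2b: everywhere ≥ 3 deep terms — the core, applied to the minimal representation
        obtain ⟨K, instF, instC, d, c', g', hd, hdeg', hcard, hdvd⟩ :=
          H p hp₁ s₀ c₀ g₀ hdeg₀ hS₀4 hrep₀ h3 hmany hmin hdeep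
        refine ⟨K, instF, instC, d, c', g', ?_, hdeg', ?_, hdvd⟩
        · exact hd.trans (hs1.trans hsA)
        · calc ∑ j, (g' j).support.card ≤ (s₀ + 1) ^ A * S₀ := hcard
            _ ≤ (s + 1) ^ (A + 1) * Srep := Nat.mul_le_mul (hs1.trans hsA) hS₀le
      · -- Step 2c: some place over `p` with at most two non-integral terms — the two-deep transfer
        push Not at hdeep
        obtain ⟨O, hpO, i, j, hint⟩ := hdeep
        obtain ⟨j', hj'i, hint'⟩ : ∃ j' : Fin s₀, i ≠ j' ∧
            ∀ k, k ≠ i → k ≠ j' → ∀ n, (Polynomial.C (c₀ k) * g₀ k ^ 2).coeff n ∈ O := by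
          by_cases hji : j = i
          · haveI : Nontrivial (Fin s₀) := Fin.nontrivial_iff_two_le.mpr (by omega)
            obtain ⟨j', hj'⟩ := exists_ne i
            exact ⟨j', fun h => hj' h.symm, fun k hki _ n => hint k hki (hji ▸ hki) n⟩
          · exact ⟨j, fun h => hji h.symm, hint⟩
        obtain ⟨K, instF, instC, c', g', hdeg', hcard, hdvd⟩ :=
          stub_twoDeepShadow p hp2 s₀ c₀ g₀ hrep₀ O hpO i j' hj'i hint'
        refine ⟨K, instF, instC, s₀, c', g', ?_, hdeg', ?_, hdvd⟩
        · calc s₀ ≤ s + 1 := by omega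
            _ ≤ (s + 1) ^ (A + 1) := hsucc
        · calc ∑ j, (g' j).support.card ≤ 2 * S₀ := hcard
            _ ≤ (s + 1) ^ (A + 1) * Srep := Nat.mul_le_mul (le_trans (by omega : 2 ≤ s + 1) hsucc) hS₀le

end Summit.ValiantsHypothesis.ValiantsHypothesis.Theorems.SublinearShadowSketch
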